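import Literature.Topology.FourManifolds.TrisectionFunctorGKStabilization
import Literature.Topology.FourManifolds.GroupTrisectionsConnectSum
import Mathlib.Tactic.Group

/-!
# `AgkCor6Sufficiency` — negative-side support: `stabilizeOne` is well defined on `Iso`-classes
# under Nielsen-liftable automorphisms

Companion of `LevelStabilizeOneRemarking.lean` (crux item `stmt-SmoothPoincare4-10894`, line
`level-set-kirby-triple`, stub `stub_levelStabilizeOne`), which shows that the stub's `∃ d' ∀ μ`
form is its one-marking geometric form PLUS the re-marking invariance
`Iso (K.stabilizeOne i) ((α • K).stabilizeOne i)` for every `α ∈ Aut S_g`.  Here that invariance is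
proved for every *liftable* `α` (`iso_stabilizeOne_map_of_lift`, the unbalanced analogue of the
tree's `TrisectionKernels.iso_stabilize_map_of_lift`: free extension along `genInclAdd`/`genShiftAdd`
for any `g + h`, the genus-`1` flip `a ↦ a⁻¹, b ↦ a b a⁻¹` with `[a,b] ↦ [a,b]⁻¹` on the nose and
`⟪a⟫`, `⟪b⟫` fixed, and `connectSum_map_conj`), hence for all `α` granted the tree's Nielsen
hypothesis `hN` of `TrisectionKernels.Iso.stabilizeIter_of_liftable` (`iso_stabilizeOne_map_of_nielsen`):
the line's hidden eighth obligation is EXACTLY `hN`, shared with fact (c′).  Everything is proved;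
no definitions, no named facts; nothing here concludes the crux, a Theses decl, or the stub.

References: Abrams–Gay–Kirby, Geom. Topol. 22 (2018), Def. 2–3 (pp. 1539–1540); Gay–Kirby, Geom.
Topol. 20 (2016), proof of Lemma 10; Lyndon–Schupp (1977), Ch. I §4 (Nielsen), Prop. II.5.8 (Magnus).
-/

noncomputable section

namespace Summit.SmoothPoincare4.SmoothPoincare4.Theorems.AgkCor6Sufficiency.Negative

open Literature.Topology.FourManifolds Subgroup

/-! ## Free extension of endomorphisms along `genInclAdd g h` / `genShiftAdd g h` -/

section FreeLevel

variable {g h : ℕ}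

/-- Endomorphisms `φ`, `τ` of the two free factors extend along `ι`, `σ`. [folklore] -/
theorem exists_freeGroup_extension_add (φ : FreeGroup (surfaceGen g) →* FreeGroup (surfaceGen g))
    (τ : FreeGroup (surfaceGen h) →* FreeGroup (surfaceGen h)) :
    ∃ E : FreeGroup (surfaceGen (g + h)) →* FreeGroup (surfaceGen (g + h)),
      E.comp (genInclAdd g h) = (genInclAdd g h).comp φ ∧
        E.comp (genShiftAdd g h) = (genShiftAdd g h).comp τ := by
  refine ⟨FreeGroup.lift fun p => Fin.addCases (motive := fun _ => FreeGroup (surfaceGen (g + h)))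
      (fun i => genInclAdd g h (φ (FreeGroup.of (i, p.2))))
      (fun j => genShiftAdd g h (τ (FreeGroup.of (j, p.2)))) p.1, ?_, ?_⟩
  · exact FreeGroup.ext_hom _ _ fun q => by simp
  · exact FreeGroup.ext_hom _ _ fun q => by simp

/-- Extensions compose. [folklore] -/
theorem freeGroup_extension_comp_add {φ φ' : FreeGroup (surfaceGen g) →* FreeGroup (surfaceGen g)}
    {τ τ' : FreeGroup (surfaceGen h) →* FreeGroup (surfaceGen h)}
    {E E' : FreeGroup (surfaceGen (g + h)) →* FreeGroup (surfaceGen (g + h))}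
    (hE₁ : E.comp (genInclAdd g h) = (genInclAdd g h).comp φ)
    (hE₂ : E.comp (genShiftAdd g h) = (genShiftAdd g h).comp τ)
    (hE'₁ : E'.comp (genInclAdd g h) = (genInclAdd g h).comp φ')
    (hE'₂ : E'.comp (genShiftAdd g h) = (genShiftAdd g h).comp τ') :
    (E'.comp E).comp (genInclAdd g h) = (genInclAdd g h).comp (φ'.comp φ) ∧
      (E'.comp E).comp (genShiftAdd g h) = (genShiftAdd g h).comp (τ'.comp τ) := by
  constructor
  · rw [MonoidHom.comp_assoc, hE₁, ← MonoidHom.comp_assoc, hE'₁, MonoidHom.comp_assoc]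
  · rw [MonoidHom.comp_assoc, hE₂, ← MonoidHom.comp_assoc, hE'₂, MonoidHom.comp_assoc]

/-- Automorphisms extend to an automorphism. [folklore] -/
theorem exists_freeGroup_mulEquiv_extension_add
    (φ : FreeGroup (surfaceGen g) ≃* FreeGroup (surfaceGen g))
    (τ : FreeGroup (surfaceGen h) ≃* FreeGroup (surfaceGen h)) :
    ∃ E : FreeGroup (surfaceGen (g + h)) ≃* FreeGroup (surfaceGen (g + h)),
      E.toMonoidHom.comp (genInclAdd g h) = (genInclAdd g h).comp φ.toMonoidHom ∧
        E.toMonoidHom.comp (genShiftAdd g h) = (genShiftAdd g h).comp τ.toMonoidHom := by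
  obtain ⟨E, hE₁, hE₂⟩ := exists_freeGroup_extension_add (g := g) (h := h) φ.toMonoidHom τ.toMonoidHom
  obtain ⟨E', hE'₁, hE'₂⟩ :=
    exists_freeGroup_extension_add (g := g) (h := h) φ.symm.toMonoidHom τ.symm.toMonoidHom
  have hφ : φ.symm.toMonoidHom.comp φ.toMonoidHom = MonoidHom.id _ :=
    MonoidHom.ext fun x => φ.symm_apply_apply x
  have hφ' : φ.toMonoidHom.comp φ.symm.toMonoidHom = MonoidHom.id _ :=
    MonoidHom.ext fun x => φ.apply_symm_apply x
  have hτ : τ.symm.toMonoidHom.comp τ.toMonoidHom = MonoidHom.id _ :=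
    MonoidHom.ext fun x => τ.symm_apply_apply x
  have hτ' : τ.toMonoidHom.comp τ.symm.toMonoidHom = MonoidHom.id _ :=
    MonoidHom.ext fun x => τ.apply_symm_apply x
  have h1 : E'.comp E = MonoidHom.id _ := by
    obtain ⟨h₁, h₂⟩ := freeGroup_extension_comp_add hE₁ hE₂ hE'₁ hE'₂
    rw [hφ] at h₁
    rw [hτ] at h₂
    exact freeGroup_hom_ext_add (by rw [h₁]; rfl) (by rw [h₂]; rfl)
  have h2 : E.comp E' = MonoidHom.id _ := by
    obtain ⟨h₁, h₂⟩ := freeGroup_extension_comp_add hE'₁ hE'₂ hE₁ hE₂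
    rw [hφ'] at h₁
    rw [hτ'] at h₂
    exact freeGroup_hom_ext_add (by rw [h₁]; rfl) (by rw [h₂]; rfl)
  exact ⟨MonoidHom.toMulEquiv E E' h1 h2, hE₁, hE₂⟩

/-- An extension `E` of `(φ, τ)` maps `r_{g+h}` to `ι(φ r_g) · σ(τ r_h)`. [folklore] -/
theorem freeGroup_extension_surfaceRelator_add
    {φ : FreeGroup (surfaceGen g) →* FreeGroup (surfaceGen g)}
    {τ : FreeGroup (surfaceGen h) →* FreeGroup (surfaceGen h)}
    {E : FreeGroup (surfaceGen (g + h)) →* FreeGroup (surfaceGen (g + h))}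
    (hE₁ : E.comp (genInclAdd g h) = (genInclAdd g h).comp φ)
    (hE₂ : E.comp (genShiftAdd g h) = (genShiftAdd g h).comp τ) :
    E (surfaceRelator (g + h)) =
      genInclAdd g h (φ (surfaceRelator g)) * genShiftAdd g h (τ (surfaceRelator h)) := by
  rw [surfaceRelator_add, map_mul]
  exact congrArg₂ (· * ·) (DFunLike.congr_fun hE₁ (surfaceRelator g))
    (DFunLike.congr_fun hE₂ (surfaceRelator h))

end FreeLevel

/-! ## The orientation flip of the genus-`1` surface group adapted to `unbalancedKernels` -/

/-- **Orientation flip of `F⟨a, b⟩`**: `θ(a) = a⁻¹`, `θ(b) = a b a⁻¹`, an involution with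
`θ([a,b]) = [a,b]⁻¹` ON THE NOSE preserving `⟪a⟫`, `⟪b⟫` (the reflection of the torus). [folklore] -/
theorem exists_flip_freeGroup_one :
    ∃ θ : FreeGroup (surfaceGen 1) ≃* FreeGroup (surfaceGen 1),
      θ (surfaceRelator 1) = (surfaceRelator 1)⁻¹ ∧ θ.symm (surfaceRelator 1) = (surfaceRelator 1)⁻¹ ∧
      (∀ p, θ (FreeGroup.of p) ∈ normalClosure ({FreeGroup.of p} : Set (FreeGroup (surfaceGen 1)))) ∧
      (∀ p, θ.symm (FreeGroup.of p) ∈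
        normalClosure ({FreeGroup.of p} : Set (FreeGroup (surfaceGen 1)))) := by
  let f : surfaceGen 1 → FreeGroup (surfaceGen 1) := fun p =>
    if p.2 then genA p.1 * genB p.1 * (genA p.1)⁻¹ else (genA p.1)⁻¹
  let θ₀ : FreeGroup (surfaceGen 1) →* FreeGroup (surfaceGen 1) := FreeGroup.lift f
  have hθ₀ : ∀ p, θ₀ (FreeGroup.of p) = f p := fun p => FreeGroup.lift_apply_of
  have hinv : θ₀.comp θ₀ = MonoidHom.id _ := by
    refine FreeGroup.ext_hom _ _ fun p => ?_
    obtain ⟨j, b⟩ := p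
    fin_cases j
    cases b
    · simp [θ₀, f, genA, genB]
    · simp [θ₀, f, genA, genB]
      group
  have hmem : ∀ p, θ₀ (FreeGroup.of p) ∈
      normalClosure ({FreeGroup.of p} : Set (FreeGroup (surfaceGen 1))) := by
    rintro ⟨j, b⟩
    rw [hθ₀]
    cases b
    · simp only [f, Bool.false_eq_true, if_false]
      exact inv_mem (subset_normalClosure (Set.mem_singleton _))
    · simp only [f, if_true]
      exact Subgroup.normalClosure_normal.conj_mem _ (subset_normalClosure (Set.mem_singleton _)) _
  have hrel : θ₀ (surfaceRelator 1) = (surfaceRelator 1)⁻¹ := by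
    simp [θ₀, f, surfaceRelator, genA, genB, List.finRange_succ]
    group
  refine ⟨MonoidHom.toMulEquiv θ₀ θ₀ hinv hinv, hrel, hrel, hmem, hmem⟩

/-! ## The `S⁴`-eye side: conjugation-like endomorphisms preserve the lifted unbalanced kernels -/

/-- An endomorphism `τ` of `F⟨a, b⟩` killing `[a,b]` modulo `⟪[a,b]⟫` and sending each generator
into its own normal closure preserves the preimage of each slot of `unbalancedKernels i`. [folklore] -/
theorem mk_apply_mem_unbalancedKernels (τ : FreeGroup (surfaceGen 1) →* FreeGroup (surfaceGen 1))
    (hr : τ (surfaceRelator 1) ∈ normalClosure ({surfaceRelator 1} : Set (FreeGroup (surfaceGen 1))))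
    (hgen : ∀ p, τ (FreeGroup.of p) ∈
      normalClosure ({FreeGroup.of p} : Set (FreeGroup (surfaceGen 1))))
    (i ι : Fin 3) {y : FreeGroup (surfaceGen 1)}
    (hy : PresentedGroup.mk ({surfaceRelator 1} : Set (FreeGroup (surfaceGen 1))) y ∈
      unbalancedKernels i ι) :
    PresentedGroup.mk ({surfaceRelator 1} : Set (FreeGroup (surfaceGen 1))) (τ y) ∈
      unbalancedKernels i ι := by
  set mk₁ := PresentedGroup.mk ({surfaceRelator 1} : Set (FreeGroup (surfaceGen 1))) with hmk₁
  set p₀ : surfaceGen 1 := ((0 : Fin 1), decide (ι = i)) with hp₀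
  have hK : unbalancedKernels i ι = normalClosure {mk₁ (FreeGroup.of p₀)} := rfl
  haveI : (unbalancedKernels i ι).Normal := by rw [hK]; infer_instance
  have h1 : (unbalancedKernels i ι).comap mk₁ =
      normalClosure {FreeGroup.of p₀} ⊔ mk₁.ker := by
    rw [← Subgroup.comap_map_eq, map_normalClosure _ _ (PresentedGroup.mk_surjective _),
      Set.image_singleton, ← hK]
  have key : (unbalancedKernels i ι).comap mk₁ ≤ (unbalancedKernels i ι).comap (mk₁.comp τ) := by
    rw [h1, sup_le_iff]
    constructor
    · refine normalClosure_le_normal ?_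
      intro z hz
      rw [Set.mem_singleton_iff] at hz
      rw [hz, SetLike.mem_coe, Subgroup.mem_comap, MonoidHom.comp_apply]
      have h2 : mk₁ (τ (FreeGroup.of p₀)) ∈ normalClosure (mk₁ '' {FreeGroup.of p₀}) :=
        map_normalClosure_le _ mk₁ ⟨_, hgen p₀, rfl⟩
      rw [Set.image_singleton] at h2
      rw [hK]
      exact h2
    · rw [ker_presentedGroup_mk_surface]
      refine normalClosure_le_normal ?_
      intro z hz
      rw [Set.mem_singleton_iff] at hz
      rw [hz, SetLike.mem_coe, Subgroup.mem_comap, MonoidHom.comp_apply,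
        PresentedGroup.mk_eq_one_iff.2 hr]
      exact one_mem _
  exact key hy

/-! ## Inner automorphisms do not change a connected sum -/

section Conj

variable {g h : ℕ}

/-- Replacing each `Kᵢ` by `d Kᵢ d⁻¹` does not change `K # L` (same normal closures).
[cite: AbramsGayKirby2018, Def. 2 (p. 1539)] -/
theorem connectSum_map_conj (K : TrisectionKernels g) (L : TrisectionKernels h) (d : SurfaceGroup g) :
    TrisectionKernels.connectSum (fun i => (K i).map (MulAut.conj d).toMonoidHom) L =
      K.connectSum L := by
  obtain ⟨d, rfl⟩ := PresentedGroup.mk_surjective _ d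
  funext i
  rw [TrisectionKernels.connectSum_apply, TrisectionKernels.connectSum_apply]
  set D : SurfaceGroup (g + h) := PresentedGroup.mk _ (genInclAdd g h d) with hD
  apply le_antisymm
  · refine normalClosure_le_normal ?_
    rintro _ (⟨x, hx, rfl⟩ | ⟨y, hy, rfl⟩)
    · have hx' : d⁻¹ * x * d ∈ (PresentedGroup.mk _) ⁻¹' (K i : Set (SurfaceGroup g)) := by
        rw [Set.mem_preimage, SetLike.mem_coe, Subgroup.mem_map_equiv, MulAut.conj_symm_apply] at hx
        rw [Set.mem_preimage, SetLike.mem_coe, map_mul, map_mul, map_inv]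
        exact hx
      have hconj : (PresentedGroup.mk _ (genInclAdd g h x) : SurfaceGroup (g + h)) =
          D * PresentedGroup.mk _ (genInclAdd g h (d⁻¹ * x * d)) * D⁻¹ := by
        simp only [hD, map_mul, map_inv]
        group
      rw [SetLike.mem_coe, Function.comp_apply, hconj]
      exact Subgroup.normalClosure_normal.conj_mem _
        (subset_normalClosure (Set.mem_union_left _
          (Set.mem_image_of_mem (PresentedGroup.mk _ ∘ genInclAdd g h) hx'))) D
    · exact subset_normalClosure (Set.mem_union_right _ (Set.mem_image_of_mem _ hy))
  · refine normalClosure_le_normal ?_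
    rintro _ (⟨x, hx, rfl⟩ | ⟨y, hy, rfl⟩)
    · have hx' : d * x * d⁻¹ ∈ (PresentedGroup.mk _) ⁻¹'
          ((K i).map (MulAut.conj (PresentedGroup.mk _ d)).toMonoidHom : Set (SurfaceGroup g)) := by
        rw [Set.mem_preimage, SetLike.mem_coe, Subgroup.mem_map_equiv, MulAut.conj_symm_apply,
          map_mul, map_mul, map_inv]
        have h' : ((PresentedGroup.mk _ d : SurfaceGroup g))⁻¹ * (PresentedGroup.mk _ d *
            PresentedGroup.mk _ x * (PresentedGroup.mk _ d)⁻¹) * PresentedGroup.mk _ d =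
            (PresentedGroup.mk _ x : SurfaceGroup g) := by
          group
        rw [h']
        exact hx
      have hconj : (PresentedGroup.mk _ (genInclAdd g h x) : SurfaceGroup (g + h)) =
          D⁻¹ * PresentedGroup.mk _ (genInclAdd g h (d * x * d⁻¹)) * D⁻¹⁻¹ := by
        simp only [hD, map_mul, map_inv]
        group
      rw [SetLike.mem_coe, Function.comp_apply, hconj]
      exact Subgroup.normalClosure_normal.conj_mem _
        (subset_normalClosure (Set.mem_union_left _
          (Set.mem_image_of_mem (PresentedGroup.mk _ ∘ genInclAdd g h) hx'))) D⁻¹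
    · exact subset_normalClosure (Set.mem_union_right _ (Set.mem_image_of_mem _ hy))

end Conj

/-! ## Isomorphism invariance of `stabilizeOne` under liftable automorphisms -/

section Main

variable {g : ℕ}

/-- The case `φ(r_g) = r_g^{±1}` with the flip `τ` of the new handle as a parameter. [folklore] -/
theorem iso_stabilizeOne_map_of_lift_aux (K : TrisectionKernels g) (i : Fin 3)
    (α : SurfaceGroup g ≃* SurfaceGroup g) (φ : FreeGroup (surfaceGen g) ≃* FreeGroup (surfaceGen g))
    {ε : ℤ} (hε : ε = 1 ∨ ε = -1) (hφr : φ (surfaceRelator g) = surfaceRelator g ^ ε)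
    (hφα : ∀ x, PresentedGroup.mk _ (φ x) = α (PresentedGroup.mk _ x))
    (τ : FreeGroup (surfaceGen 1) ≃* FreeGroup (surfaceGen 1))
    (hτr : τ (surfaceRelator 1) = surfaceRelator 1 ^ ε)
    (hτr' : τ.symm (surfaceRelator 1) ∈
      normalClosure ({surfaceRelator 1} : Set (FreeGroup (surfaceGen 1))))
    (hτ : ∀ p, τ (FreeGroup.of p) ∈ normalClosure ({FreeGroup.of p} : Set (FreeGroup (surfaceGen 1))))
    (hτ' : ∀ p, τ.symm (FreeGroup.of p) ∈
      normalClosure ({FreeGroup.of p} : Set (FreeGroup (surfaceGen 1)))) :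
    TrisectionKernels.Iso (K.stabilizeOne i)
      (TrisectionKernels.stabilizeOne (fun j => (K j).map α.toMonoidHom) i) := by
  obtain ⟨E, hE₁, hE₂⟩ := exists_freeGroup_mulEquiv_extension_add φ τ
  have hE₁x : ∀ x, E (genInclAdd g 1 x) = genInclAdd g 1 (φ x) := fun x => by
    simpa using DFunLike.congr_fun hE₁ x
  have hE₂y : ∀ y, E (genShiftAdd g 1 y) = genShiftAdd g 1 (τ y) := fun y => by
    simpa using DFunLike.congr_fun hE₂ y
  have hEr : E (surfaceRelator (g + 1)) =
      genInclAdd g 1 (surfaceRelator g ^ ε) * genShiftAdd g 1 (surfaceRelator 1 ^ ε) := by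
    rw [← hφr, ← hτr]
    simpa using freeGroup_extension_surfaceRelator_add hE₁ hE₂
  have hN : normalClosure ({E (surfaceRelator (g + 1))} : Set (FreeGroup (surfaceGen (g + 1)))) =
      normalClosure {surfaceRelator (g + 1)} := by
    rcases hε with rfl | rfl
    · rw [hEr, zpow_one, zpow_one, ← surfaceRelator_add g 1]
    · refine normalClosure_singleton_eq_of_eq_conj_zpow (c := (genInclAdd g 1 (surfaceRelator g))⁻¹)
        (Or.inr rfl) ?_
      rw [hEr, surfaceRelator_add g 1, map_zpow, map_zpow]
      group
  obtain ⟨β, hβ⟩ := exists_surfaceGroup_mulEquiv_of_free E hN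
  have hτr₁ : τ (surfaceRelator 1) ∈
      normalClosure ({surfaceRelator 1} : Set (FreeGroup (surfaceGen 1))) := by
    rw [hτr]
    exact zpow_mem (subset_normalClosure (Set.mem_singleton _)) ε
  refine ⟨β, fun ι => ?_⟩
  rw [TrisectionKernels.stabilizeOne_eq_connectSum, TrisectionKernels.stabilizeOne_eq_connectSum,
    TrisectionKernels.connectSum_apply, TrisectionKernels.connectSum_apply,
    map_normalClosure _ _ β.surjective]
  congr 1
  ext z
  constructor
  · rintro ⟨w, (⟨x, hx, rfl⟩ | ⟨y, hy, rfl⟩), rfl⟩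
    · refine Or.inl ⟨φ x, ?_, ?_⟩
      · rw [Set.mem_preimage, SetLike.mem_coe, hφα, Subgroup.mem_map_equiv, MulEquiv.symm_apply_apply]
        exact hx
      · simp only [Function.comp_apply, MulEquiv.coe_toMonoidHom, hβ, hE₁x]
    · refine Or.inr ⟨τ y, mk_apply_mem_unbalancedKernels τ.toMonoidHom hτr₁ hτ i ι hy, ?_⟩
      simp only [Function.comp_apply, MulEquiv.coe_toMonoidHom, hβ, hE₂y]
  · rintro (⟨x, hx, rfl⟩ | ⟨y, hy, rfl⟩)
    · refine ⟨PresentedGroup.mk _ (genInclAdd g 1 (φ.symm x)), Or.inl ⟨φ.symm x, ?_, rfl⟩, ?_⟩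
      · rw [Set.mem_preimage, SetLike.mem_coe, Subgroup.mem_map_equiv] at hx
        rw [Set.mem_preimage, SetLike.mem_coe]
        have h := hφα (φ.symm x)
        rw [MulEquiv.apply_symm_apply] at h
        rw [← α.symm_apply_apply (PresentedGroup.mk _ (φ.symm x)), ← h]
        exact hx
      · simp only [Function.comp_apply, MulEquiv.coe_toMonoidHom, hβ, hE₁x, MulEquiv.apply_symm_apply]
    · refine ⟨PresentedGroup.mk _ (genShiftAdd g 1 (τ.symm y)),
        Or.inr ⟨τ.symm y, mk_apply_mem_unbalancedKernels τ.symm.toMonoidHom hτr' hτ' i ι hy, rfl⟩, ?_⟩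
      simp only [Function.comp_apply, MulEquiv.coe_toMonoidHom, hβ, hE₂y, MulEquiv.apply_symm_apply]

/-- **`stabilizeOne` is well defined on isomorphism classes, for liftable automorphisms**
(unbalanced analogue of `TrisectionKernels.iso_stabilize_map_of_lift`): if `α ∈ Aut S_g` is
induced by a free automorphism `φ` with `φ(r_g)` conjugate to `r_g^{±1}`, then
`Iso (K.stabilizeOne i) ((α • K).stabilizeOne i)`.
[cite: AbramsGayKirby2018, Def. 2–3 (pp. 1539–1540)] [cite: GayKirby2016, proof of Lemma 10] -/
theorem iso_stabilizeOne_map_of_lift (K : TrisectionKernels g) (i : Fin 3)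
    (α : SurfaceGroup g ≃* SurfaceGroup g)
    (hα : ∃ (φ : FreeGroup (surfaceGen g) ≃* FreeGroup (surfaceGen g)) (c : FreeGroup (surfaceGen g))
      (ε : ℤ), (ε = 1 ∨ ε = -1) ∧ φ (surfaceRelator g) = c * surfaceRelator g ^ ε * c⁻¹ ∧
      ∀ x, PresentedGroup.mk _ (φ x) = α (PresentedGroup.mk _ x)) :
    TrisectionKernels.Iso (K.stabilizeOne i)
      (TrisectionKernels.stabilizeOne (fun j => (K j).map α.toMonoidHom) i) := by
  obtain ⟨φ, c, ε, hε, hφr, hφα⟩ := hα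
  let φ' : FreeGroup (surfaceGen g) ≃* FreeGroup (surfaceGen g) := φ.trans (MulAut.conj c⁻¹)
  let α' : SurfaceGroup g ≃* SurfaceGroup g :=
    α.trans (MulAut.conj (PresentedGroup.mk ({surfaceRelator g} : Set _) c)⁻¹)
  have hφ'r : φ' (surfaceRelator g) = surfaceRelator g ^ ε := by
    simp only [φ', MulEquiv.trans_apply, MulAut.conj_apply, hφr, inv_inv]
    group
  have hφ'α : ∀ x, PresentedGroup.mk _ (φ' x) = α' (PresentedGroup.mk _ x) := fun x => by
    show PresentedGroup.mk _ (c⁻¹ * φ x * c⁻¹⁻¹) =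
      (PresentedGroup.mk _ c)⁻¹ * α (PresentedGroup.mk _ x) * (PresentedGroup.mk _ c)⁻¹⁻¹
    simp only [map_mul, map_inv, hφα]
  have hK : TrisectionKernels.stabilizeOne (fun j => (K j).map α'.toMonoidHom) i =
      TrisectionKernels.stabilizeOne (fun j => (K j).map α.toMonoidHom) i := by
    have : (fun j => (K j).map α'.toMonoidHom : TrisectionKernels g) = fun j =>
        ((K j).map α.toMonoidHom).map
          (MulAut.conj (PresentedGroup.mk ({surfaceRelator g} : Set _) c)⁻¹).toMonoidHom := by
      funext j
      rw [Subgroup.map_map]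
      rfl
    rw [this, TrisectionKernels.stabilizeOne_eq_connectSum, TrisectionKernels.stabilizeOne_eq_connectSum,
      connectSum_map_conj]
  rw [← hK]
  rcases hε with rfl | rfl
  · exact iso_stabilizeOne_map_of_lift_aux K i α' φ' (Or.inl rfl) hφ'r hφ'α
      (MulEquiv.refl _) (by simp) (by simpa using subset_normalClosure (Set.mem_singleton _))
      (fun p => subset_normalClosure (Set.mem_singleton _))
      (fun p => subset_normalClosure (Set.mem_singleton _))
  · obtain ⟨θ, hθr, hθr', hθ, hθ'⟩ := exists_flip_freeGroup_one
    exact iso_stabilizeOne_map_of_lift_aux K i α' φ' (Or.inr rfl) hφ'r hφ'α θ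
      (by rw [hθr, zpow_neg_one])
      (by rw [hθr']; exact inv_mem (subset_normalClosure (Set.mem_singleton _))) hθ hθ'

/-- `Iso` form: an isomorphism of kernel triples witnessed by a liftable automorphism passes to the
unbalanced stabilisations (analogue of `TrisectionKernels.Iso.stabilize_of_lift`).
[cite: AbramsGayKirby2018, Def. 2–3 (pp. 1539–1540)] -/
theorem iso_stabilizeOne_of_lift {K K' : TrisectionKernels g} (i : Fin 3)
    (h : ∃ α : SurfaceGroup g ≃* SurfaceGroup g,
      (∃ (φ : FreeGroup (surfaceGen g) ≃* FreeGroup (surfaceGen g)) (c : FreeGroup (surfaceGen g))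
        (ε : ℤ), (ε = 1 ∨ ε = -1) ∧ φ (surfaceRelator g) = c * surfaceRelator g ^ ε * c⁻¹ ∧
        ∀ x, PresentedGroup.mk _ (φ x) = α (PresentedGroup.mk _ x)) ∧
      ∀ j, (K j).map α.toMonoidHom = K' j) :
    TrisectionKernels.Iso (K.stabilizeOne i) (K'.stabilizeOne i) := by
  obtain ⟨α, hα, hK⟩ := h
  obtain rfl : K' = fun j => (K j).map α.toMonoidHom := funext fun j => (hK j).symm
  exact iso_stabilizeOne_map_of_lift K i α hα

/-- Granted Nielsen (`hN`), `Iso` passes to unbalanced stabilisations. [cite: AbramsGayKirby2018, Def. 3 (p. 1540)] -/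
theorem iso_stabilizeOne_of_nielsen
    (hN : ∀ (G : ℕ) (α : SurfaceGroup G ≃* SurfaceGroup G),
      ∃ (φ : FreeGroup (surfaceGen G) ≃* FreeGroup (surfaceGen G)) (c : FreeGroup (surfaceGen G))
        (ε : ℤ), (ε = 1 ∨ ε = -1) ∧ φ (surfaceRelator G) = c * surfaceRelator G ^ ε * c⁻¹ ∧
        ∀ x, PresentedGroup.mk _ (φ x) = α (PresentedGroup.mk _ x))
    {K K' : TrisectionKernels g} (hK : K.Iso K') (i : Fin 3) :
    TrisectionKernels.Iso (K.stabilizeOne i) (K'.stabilizeOne i) := by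
  obtain ⟨α, hα⟩ := hK
  exact iso_stabilizeOne_of_lift i ⟨α, hN g α, hα⟩

/-- **The hidden eighth obligation is the tree's `hN`, no more**: granted Nielsen (`hN` of
`TrisectionKernels.Iso.stabilizeIter_of_liftable`), `stabilizeOne` is re-marking invariant on EVERY
kernel triple (the `hinv` shape of `forall_markings_iso_iff_forall_mulEquiv`).
[cite: AbramsGayKirby2018, Def. 3 (p. 1540)] -/
theorem iso_stabilizeOne_map_of_nielsen
    (hN : ∀ (G : ℕ) (α : SurfaceGroup G ≃* SurfaceGroup G),
      ∃ (φ : FreeGroup (surfaceGen G) ≃* FreeGroup (surfaceGen G)) (c : FreeGroup (surfaceGen G))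
        (ε : ℤ), (ε = 1 ∨ ε = -1) ∧ φ (surfaceRelator G) = c * surfaceRelator G ^ ε * c⁻¹ ∧
        ∀ x, PresentedGroup.mk _ (φ x) = α (PresentedGroup.mk _ x))
    (K : TrisectionKernels g) (i : Fin 3) (α : SurfaceGroup g ≃* SurfaceGroup g) :
    TrisectionKernels.Iso (K.stabilizeOne i)
      (TrisectionKernels.stabilizeOne (fun j => (K j).map α.toMonoidHom) i) :=
  iso_stabilizeOne_map_of_lift K i α (hN g α)

end Main

end Summit.SmoothPoincare4.SmoothPoincare4.Theorems.AgkCor6Sufficiency.Negative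

end
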